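import Summits.ResolutionOfSingularities.ResolutionOfSingularities.Theorems.SharpStrataSepExcModelsDefs
import Summits.ResolutionOfSingularities.ResolutionOfSingularities.Theorems.SharpStrataSepExcModelsSpecializationClosure
import Summits.ResolutionOfSingularities.ResolutionOfSingularities.Theorems.SharpStrataSepExcModelsRegularOrClosedSpreads
import Summits.ResolutionOfSingularities.ResolutionOfSingularities.Theorems.SharpStrataSepExcModelsModelSpreads
import Summits.ResolutionOfSingularities.ResolutionOfSingularities.Theorems.SharpStrataSepExcModelsNormalizedBlowup
import Literature.AlgebraicGeometry.Resolution.RegularLocusDense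
import HarnessLib

/-!
# Route SharpStrata — crux `SepExcModels` (stmt-ResolutionOfSingularities-16828): the Kolchin phase is
# well defined, and the crux follows from its termination

Line `registered` (`Cruxes/SepExcModels/Lines/birth.lean`), lead seat 0, cycle 1. Over the vocabulary of
`SharpStrataSepExcModelsDefs.lean` (`SepExcAt`, `sharpLocus`, `sharpCentre`, `IsKolchinStep`, `KVariety`,
`KolchinRel`) and the four landed stubs of wave 1, this file PROVES:

* `sharpCentre_ne_univ` — the generic point of an integral scheme is blunt (its local ring is a field,
  hence regular) and is a specialisation of nothing else, so the sharp centre is a proper subset;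
* `bluntSpreads` — PROPAGATION OF BLUNTNESS (Benito–Piltant–Reguera 2022, Prop. 2.1 / Lemma 4.2 in
  valuative dress): a separably exceptional point is not a limit of sharp points of its own stratum
  (regular / closed case: `stub_regularOrClosedSpreads`; model case: `stub_modelSpreads`);
* `isClosed_sharpCentre` — **the sharp strata are closed** (finitely many maximal sharp points): the
  pure-topology closure lemma `stub_specializationClosure_isClosed` applied to the sharp locus, whose
  hypothesis is `bluntSpreads` contraposed;
* `exists_kolchinStep` — **the Kolchin step exists** and is a proper birational modification with
  integral source (`stub_normalizedBlowup` at the closed proper centre `sharpCentre Y`);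
* `sepExcModels_of_kolchinTerminates` — **the crux `SepExcModels` follows from TERMINATION of the
  canonical Kolchin phase** (`∀ V, Acc (KolchinRel k) V`; BPR Question 6.6 for the canonical process —
  the one remaining registered stub `stub_kolchinTerminates` of the line, an open problem in print): by
  `Acc`-recursion, a variety without sharp points is its own separably exceptional model, otherwise
  compose the Kolchin step with the model of its (accessible) successor.

Sources: A. Benito, O. Piltant, A. J. Reguera, JPAA 226 (2022) 107110, Prop. 2.1, Lemma 4.2, Prop. 4.3,
Question 6.6 [BenitoPiltantReguera2022]; Q. Liu, *Algebraic Geometry and Arithmetic Curves*, §8.3.4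
(3.11) (normalised blow-up steps) [Liu2002]. NOT here: any proof of termination.
-/

noncomputable section

-- single-problem summit: the doubled namespace component `ResolutionOfSingularities` is forced
set_option linter.dupNamespace false

open CategoryTheory AlgebraicGeometry TopologicalSpace Topology
open Literature.AlgebraicGeometry.Resolution

namespace Summit.ResolutionOfSingularities.ResolutionOfSingularities.Theorems.SepExcModels

/-- **Propagation of bluntness** (derived from the two landed spreading stubs; no `sorry`): a
separably exceptional point `w` is not in the closure of the sharp points of its stratum
`cl{w}`. Regular / closed `w`: `stub_regularOrClosedSpreads` and monotonicity of closure (a sharp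
point is in particular non-regular and non-closed). Model case: `stub_modelSpreads` gives an open
`U ∋ w` all of whose points on `cl{w}` satisfy the third disjunct, so `U` misses
`sharpLocus Y ∩ cl{w}`. [cite: BenitoPiltantReguera2022, Prop. 2.1, Lemma 4.2] -/
theorem bluntSpreads (k : Type) [Field k] (Y : Scheme.{0}) [IsIntegral Y]
    (f : Y ⟶ Spec (.of k)) [LocallyOfFiniteType f] (w : Y) (hw : SepExcAt Y w) :
    w ∉ closure (sharpLocus Y ∩ closure {w}) := by
  rcases hw with hreg | hcl | ⟨s, 𝔮, h𝔮, hle, hregq, g, hg, hsm⟩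
  · refine fun h => RegularOrClosedSpreads.stub_regularOrClosedSpreads k Y f w
      (Or.inl hreg) (closure_mono ?_ h)
    exact Set.inter_subset_inter_left _ fun ζ hζ hζ' => hζ (hζ'.elim Or.inl (fun h => Or.inr (Or.inl h)))
  · refine fun h => RegularOrClosedSpreads.stub_regularOrClosedSpreads k Y f w
      (Or.inr hcl) (closure_mono ?_ h)
    exact Set.inter_subset_inter_left _ fun ζ hζ hζ' => hζ (hζ'.elim Or.inl (fun h => Or.inr (Or.inl h)))
  · haveI := h𝔮
    obtain ⟨U, hU, hwU, hall⟩ :=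
      ModelSpreads.stub_modelSpreads k Y f w s 𝔮 hle hregq g hg hsm
    intro h
    obtain ⟨w', hw'U, hw'S, hw'cl⟩ := mem_closure_iff.mp h U hU hwU
    obtain ⟨s', 𝔮', h𝔮', hle', hreg', g', hg', hsm'⟩ := hall w' ⟨hw'U, hw'cl⟩
    exact hw'S (Or.inr (Or.inr ⟨s', 𝔮', h𝔮', hle', hreg', g', hg', hsm'⟩))

/-- The generic point is not in the sharp centre, so the sharp centre is a proper subset: the
local ring at the generic point of an integral scheme is a field, hence regular
(`isRegularLocalRing_stalk_of_mem_genericPoints`), so the generic point is blunt; and a point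
specialising to the generic point is the generic point (`eq_of_specializes_of_mem_genericPoints`).
[folklore] -/
theorem sharpCentre_ne_univ (Y : Scheme.{0}) [IsIntegral Y] : sharpCentre Y ≠ Set.univ := by
  intro h
  have hξ : genericPoint Y ∈ sharpCentre Y := h ▸ Set.mem_univ _
  obtain ⟨ζ, hζ, hsp⟩ := hξ
  have hgen : genericPoint Y ∈ genericPoints Y := by
    change closure {genericPoint Y} ∈ irreducibleComponents Y
    rw [genericPoint_closure]
    exact irreducibleComponents_eq_maximals_closed Y ▸
      ⟨⟨isClosed_univ, IrreducibleSpace.isIrreducible_univ Y⟩,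
        fun s hs _ => Set.subset_univ s⟩
  have hζeq : ζ = genericPoint Y := eq_of_specializes_of_mem_genericPoints hgen hsp
  subst hζeq
  exact hζ (Or.inl (isRegularLocalRing_stalk_of_mem_genericPoints hgen))

/-- **The sharp strata are closed** (finitely many maximal sharp points; BPR Prop. 2.1 in valuative
dress): for an integral scheme locally of finite type and quasi-compact over a field, the sharp centre
`⋃_{ζ sharp} cl{ζ}` is closed — the topology lemma `stub_specializationClosure_isClosed` for
`S = sharpLocus Y` (a Noetherian scheme is a Noetherian quasi-sober space), whose hypothesis is
propagation of bluntness. [cite: BenitoPiltantReguera2022, Prop. 2.1] -/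
theorem isClosed_sharpCentre (k : Type) [Field k] (Y : Scheme.{0}) [IsIntegral Y]
    (f : Y ⟶ Spec (.of k)) [LocallyOfFiniteType f] [QuasiCompact f] : IsClosed (sharpCentre Y) := by
  haveI : IsLocallyNoetherian Y := LocallyOfFiniteType.isLocallyNoetherian f
  haveI : CompactSpace Y := QuasiCompact.compactSpace_of_compactSpace f
  haveI : IsNoetherian Y := ⟨⟩
  refine SpecializationClosure.stub_specializationClosure_isClosed Y (sharpLocus Y) fun w hw => ?_
  by_contra hbl
  exact bluntSpreads k Y f w (not_not.mp hbl) hw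

/-- **The Kolchin step exists and is a proper birational modification** with integral source: the
normalised blow-up of the (closed, proper) reduced sharp centre (`stub_normalizedBlowup`); the data it
returns is literally `IsKolchinStep`. [cite: BenitoPiltantReguera2022, Question 6.6] -/
theorem exists_kolchinStep (k : Type) [Field k] (Y : Scheme.{0}) [IsIntegral Y]
    (f : Y ⟶ Spec (.of k)) [LocallyOfFiniteType f] (hS : IsClosed (sharpCentre Y)) :
    ∃ (Y' : Scheme.{0}) (_ : IsIntegral Y') (π : Y' ⟶ Y),
      IsKolchinStep π ∧ IsProper π ∧ IsBirational π := by
  obtain ⟨Y', hY', π, ⟨B, β, hB, e, hblow, hcomp⟩, hπp, hπb⟩ :=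
    NormalizedBlowup.stub_normalizedBlowup k Y f ⟨sharpCentre Y, hS⟩ (sharpCentre_ne_univ Y)
  exact ⟨Y', hY', π, ⟨hS, B, β, hB, e, hblow, hcomp⟩, hπp, hπb⟩

/-- **The crux `SepExcModels` from TERMINATION of the canonical Kolchin phase** (registered headline
`sepExcModels_of_kolchinTerminates`; the hypothesis is verbatim the statement of the line's one open
stub `stub_kolchinTerminates` — BPR Question 6.6 for the canonical process). Fix `p`, a perfect `k` and
an integral separated `X/k` of finite type; by `Acc`-recursion along `KolchinRel k` every `V : KVariety k`
has a proper birational separably exceptional model: if `V` has no sharp point, `𝟙 V` is one (this is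
the definition, `sepExc_iff_forall_sepExcAt`); otherwise the sharp centre is closed
(`isClosed_sharpCentre`), a Kolchin step `π : V⁺ ⟶ V` exists (`exists_kolchinStep`), `V⁺ ≺ V`, the
recursion hypothesis gives `X'' ⟶ V⁺`, and proper / birational morphisms compose.
[cite: BenitoPiltantReguera2022, Question 6.6] -/
theorem sepExcModels_of_kolchinTerminates
    (h : ∀ p : ℕ, p.Prime → ∀ (k : Type) [Field k] [CharP k p] [PerfectField k] (V : KVariety k),
      Acc (KolchinRel k) V) :
    Theses.SharpStrata.SepExcModels := by
  intro p hp k _ _ _ X _ f hs hl hq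
  suffices main : ∀ V : KVariety k, ∃ (X' : Scheme.{0}) (_ : IsIntegral X') (π : X' ⟶ V.X),
      IsProper π ∧ IsBirational π ∧ SharpStrata.SepExc X' by
    haveI := hs; haveI := hl; haveI := hq
    exact main (KVariety.mk X f)
  intro V
  induction h p hp k V with
  | intro V _ ih =>
    by_cases hne : (sharpLocus V.X).Nonempty
    · have hS := isClosed_sharpCentre k V.X V.hom
      obtain ⟨Y', hY', π, hstep, hπp, hπb⟩ := exists_kolchinStep k V.X V.hom hS
      haveI := hY'; haveI := hπp
      obtain ⟨X'', hX'', π', hp', hb', hsep⟩ :=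
        ih (KVariety.mk Y' (π ≫ V.hom)) ⟨hne, π, rfl, hstep⟩
      haveI := hp'
      exact ⟨X'', hX'', π' ≫ π, inferInstance, ComponentGluing.IsBirational.comp hb' hπb, hsep⟩
    · -- the identity is birational over `U = ⊤` (cf. `WeightedThesis.KunzTower.isBirational_id'`)
      refine ⟨V.X, inferInstance, 𝟙 _, inferInstance, ⟨⊤, by simp, by simp, inferInstance⟩, ?_⟩
      exact sepExc_of_sharpLocus_eq_empty (Set.not_nonempty_iff_eq_empty.mp hne)

end Summit.ResolutionOfSingularities.ResolutionOfSingularities.Theorems.SepExcModels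

end
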